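/-
Origin: expansion seat `prover-pub-hodgecm-mc-binder-2-g7-0`, handover #21 19:55Z md5 c51086e34395 (183 l.; imports #20 + the twin of `AlgebraicGroups/FewVectorsUnitaryInvariants` — INSTALL AFTER #20 and the four twins, DROP-ONLY-THIS-ROW otherwise; (J-dense)/(J-x₀) at a D₁₂ place, POLYNOMIAL LEVEL: `matToDPIdx eA eR : Fin n × Fin m → DPIdx P' Q' R' S'` (`(i,k) ↦ (eA i, eR k)`; injective; surjective when `[IsEmpty Q'] [IsEmpty S']`), DICTIONARY **`linSubst_star_dualPairι_kV_rename_matToDPIdx`**: `linSubst (dualPairι ((a,b),(1,1)))⋆ (rename j F) = rename j (leftTranslate (vcMatrix eA a) F)`, `det_vcMatrix`/`det_ofVCMatrix` (= det), transfers `leftTranslate_eq_of_kV` / `det_pow_mul_leftTranslate_eq_of_kV`, and **`eq_C_of_kV_invariant_delta [IsEmpty Q'] [IsEmpty S']`** (K_V-invariant ⟹ constant), **`eq_zero_of_kV_relInvariant_delta (∣R'∣ < ∣P'∣, e ≠ 0)`** (`linSubst … G = C (det a ^ e) * G` ⟹ G = 0), **`eq_zero_of_kV_relInvariant_delta_neg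 [Nonempty P'] (e ≠ 0)`** (`C (det a ^ e) * linSubst … G = G` ⟹ G = 0) ⇒ the K_{V,b}-isotypic Fock polynomials of a doubly definite slot are ℂ·1 or 0 = pv12's printed `1`; farm amalgam (tree leaf in the snapshot) rc 0 / 0 err / 0 warn / 0 proof-hole, `#print axioms eq_zero_of_kV_relInvariant_delta` = trio (`g7/certs/InvariantSlotDelta_amalg.json`)) (`HOME/mc/pub-hodgecm-mc-binder-2/g7/pkg/HodgeCM/Model/HypCensus/InvariantSlotDelta.lean`, md5 c51086e3, 183 lines);
landed by the gen-13 packager (p-g13) in gate run 37 as `HodgeCM/Model/HypCensus/InvariantSlotDelta.lean` (verbatim).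
-/
/-
Origin: speedrun cell pub-hodgecm, MODEL-CONSTRUCTION sub-cell, lineage mc-binder-2 (rows A12/A34 of the binder ledger:
`hyp12` / `hyp34`), seat prover-pub-hodgecm-mc-binder-2-g7-0 (gen 7), 2026-08-19.  Target in PKG:
`HodgeCM/Model/HypCensus/InvariantSlotDelta.lean` (NEW additive leaf; imports this lineage's `InvariantSlot` and the K-1 twin of
tree `RepresentationTheory/AlgebraicGroups/FewVectorsUnitaryInvariants` (p194105; twin NOT YET in PKG — install after it)).
KERNEL only: 0 records / named facts / proof holes.
-/
import Summits.HodgeConjecture.HodgeCM.Model.HypCensus.InvariantSlot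
import Literature.RepresentationTheory.AlgebraicGroups.FewVectorsUnitaryInvariants

/-!
# Census kit (rows A12/A34), (J-dense)/(J-x₀) at a `D₁₂` place, polynomial level: the `K_V`-isotypic Fock polynomials
# of a doubly definite slot are the constants (or zero)

At a `D₁₂` place both `V_b` (rank `n`, `P' ≃ Fin n`, `Q' = ∅`) and `W_b` (rank `m`, positive: `R' ≃ Fin m`, `S' = ∅`) are
definite, so the slot's Fock variables are the `n × m` same-sign variables `X_{(p,r)}` only, on which Konno–Konno's `K_V = U(P')`
acts by `X_{(p,r)} ↦ Σ_{p'} a_{p'p} X_{(p',r)}` (`InvariantSlot.linSubst_star_dualPairι_kV_X_inl_inl`) — the tree's left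
translation `leftTranslate` of polynomial functions of `n × m` matrices by `vcMatrix eA a = (a∘eA)ᵀ`.  Transporting the tree leaf
`AlgebraicGroups/FewVectorsUnitaryInvariants`:

* `matToDPIdx eA eR : Fin n × Fin m → DPIdx P' Q' R' S'`, `(i,k) ↦ (eA i, eR k)` (injective; surjective when `Q' = S' = ∅`);
* **`linSubst_star_dualPairι_kV_rename_matToDPIdx`**: `linSubst (dualPairι ((a,b),(1,1)))⋆ (rename j F) = rename j (leftTranslate (vcMatrix eA a) F)`;
* **`eq_C_of_kV_invariant_delta`** (`[IsEmpty Q'] [IsEmpty S']`, any ranks): `K_V`-invariant ⟹ constant;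
* **`eq_zero_of_kV_relInvariant_delta`** (`|R'| < |P'|`, exponent `≠ 0`): `linSubst (…) G = C (det a ^ e) * G` for all `a` ⟹ `G = 0`;
  **`eq_zero_of_kV_relInvariant_delta_neg`** (`[Nonempty P']`, exponent `≠ 0`): `C (det a ^ e) * linSubst (…) G = G` for all `a` ⟹ `G = 0`.

So the `K_{V,b}`-isotypic Fock polynomials at a `D₁₂` place (character a power of `det`, after the scalar match of the census) are
`ℂ · 1` or `0` — pv12's printed vector `1`.  [GoodmanWallachGTM255, §5.2.1; Folland1989, Prop. (4.39)]  Nothing here is a claim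
of PerL/QW8.  Style lint (L-notation): no `local notation`.
-/

set_option autoImplicit false

noncomputable section

open MvPolynomial Complex
open scoped BigOperators ComplexConjugate Kronecker Matrix
open Literature.Analysis.SegalBargmann
open Literature.RepresentationTheory.ClassicalInvariants
open Literature.RepresentationTheory.AlgebraicGroups

namespace HodgeCM.Model.HypCensus

section Delta

variable {P' Q' R' S' : Type} [Fintype P'] [DecidableEq P'] [Fintype Q'] [DecidableEq Q'] [Fintype R'] [DecidableEq R']
  [Fintype S'] [DecidableEq S'] {n m : ℕ} (eA : Fin n ≃ P') (eR : Fin m ≃ R')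

/-! ## §1 The variables of a doubly definite slot -/

/-- the `n × m` matrix variables into the slot: `(i,k) ↦ X_{(eA i, eR k)}` (same-sign block `P' × R'`). -/
def matToDPIdx : Fin n × Fin m → DPIdx P' Q' R' S' := fun q => Sum.inl (Sum.inl (eA q.1, eR q.2))

omit [Fintype P'] [DecidableEq P'] [Fintype Q'] [DecidableEq Q'] [Fintype R'] [DecidableEq R'] [Fintype S'] [DecidableEq S'] in
/-- (Ported verbatim from the HodgeCMPerL package; no docstring in the source.) -/
@[simp] theorem matToDPIdx_apply (q : Fin n × Fin m) :
    matToDPIdx (Q' := Q') (S' := S') eA eR q = Sum.inl (Sum.inl (eA q.1, eR q.2)) := rfl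

omit [Fintype P'] [DecidableEq P'] [Fintype Q'] [DecidableEq Q'] [Fintype R'] [DecidableEq R'] [Fintype S'] [DecidableEq S'] in
/-- `matToDPIdx` is injective. [folklore] -/
theorem matToDPIdx_injective : Function.Injective (matToDPIdx (Q' := Q') (S' := S') eA eR) := by
  intro q q' h
  simp only [matToDPIdx_apply, Sum.inl.injEq, Prod.mk.injEq, eA.injective.eq_iff, eR.injective.eq_iff] at h
  exact Prod.ext h.1 h.2

omit [Fintype P'] [DecidableEq P'] [Fintype Q'] [DecidableEq Q'] [Fintype R'] [DecidableEq R'] [Fintype S'] [DecidableEq S'] in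
/-- in a doubly definite slot (`Q' = S' = ∅`) every variable is a `matToDPIdx`-image. [folklore] -/
theorem matToDPIdx_surjective [IsEmpty Q'] [IsEmpty S'] : Function.Surjective (matToDPIdx (Q' := Q') (S' := S') eA eR) := by
  rintro ((⟨p, r⟩ | ⟨q, _⟩) | (⟨_, s⟩ | ⟨q, _⟩))
  · exact ⟨(eA.symm p, eR.symm r), by rw [matToDPIdx_apply, eA.apply_symm_apply, eR.apply_symm_apply]⟩
  · exact isEmptyElim q
  · exact isEmptyElim s
  · exact isEmptyElim q

/-! ## §2 The dictionary with the tree's left translation -/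

/-- **THE DICTIONARY**: Konno–Konno's `K_V`-letter on the renamed matrix polynomial IS the tree's left translation by
`vcMatrix eA a = (a∘eA)ᵀ`: `linSubst (dualPairι ((a,b),(1,1)))⋆ (rename j F) = rename j (leftTranslate (vcMatrix eA a) F)`.
[Folland1989, Prop. (4.39); Sturmfels1993, §3.2] -/
theorem linSubst_star_dualPairι_kV_rename_matToDPIdx (a : Matrix.unitaryGroup P' ℂ) (b : Matrix.unitaryGroup Q' ℂ)
    (F : MvPolynomial (Fin n × Fin m) ℂ) :
    linSubst (star ((dualPairι (((a, b), (1, 1)) : DPK P' Q' R' S') : Matrix.unitaryGroup (DPIdx P' Q' R' S') ℂ) :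
        Matrix (DPIdx P' Q' R' S') (DPIdx P' Q' R' S') ℂ)) (rename (matToDPIdx eA eR) F) =
      rename (matToDPIdx eA eR) (leftTranslate (vcMatrix eA (a : Matrix P' P' ℂ)) F) := by
  suffices h : (linSubst (star ((dualPairι (((a, b), (1, 1)) : DPK P' Q' R' S') : Matrix.unitaryGroup (DPIdx P' Q' R' S') ℂ) :
        Matrix (DPIdx P' Q' R' S') (DPIdx P' Q' R' S') ℂ))).comp (rename (matToDPIdx eA eR)) =
      (rename (matToDPIdx eA eR)).comp (leftTranslate (vcMatrix eA (a : Matrix P' P' ℂ))) from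
    DFunLike.congr_fun h F
  refine MvPolynomial.algHom_ext fun q => ?_
  rw [AlgHom.comp_apply, AlgHom.comp_apply, rename_X, matToDPIdx_apply, linSubst_star_dualPairι_kV_X_inl_inl,
    leftTranslate_X, map_sum]
  simp only [map_mul, rename_C, rename_X, matToDPIdx_apply, vcMatrix]
  exact (eA.sum_comp fun p' => C ((a : Matrix P' P' ℂ) p' (eA q.1)) * X (Sum.inl (Sum.inl (p', eR q.2)))).symm

/-- `det (vcMatrix eA a) = det a`. [folklore] -/
theorem det_vcMatrix (a : Matrix P' P' ℂ) : (vcMatrix eA a).det = a.det := by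
  rw [vcMatrix_eq, Matrix.det_transpose, Matrix.det_submatrix_equiv_self]

/-- `det (ofVCMatrix eA g) = det g`. [folklore] -/
theorem det_ofVCMatrix (g : Matrix (Fin n) (Fin n) ℂ) : (ofVCMatrix eA g).det = g.det := by
  rw [ofVCMatrix_eq, Matrix.det_transpose, Matrix.det_submatrix_equiv_self]

/-- transfer of an invariance clause from the `K_V`-letters to the tree's left translations (through `ofVCMatrix`). [folklore] -/
theorem leftTranslate_eq_of_kV {F : MvPolynomial (Fin n × Fin m) ℂ} {e : ℕ}
    (h : ∀ a : Matrix.unitaryGroup P' ℂ,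
      linSubst (star ((dualPairι (((a, (1 : Matrix.unitaryGroup Q' ℂ)), (1, 1)) : DPK P' Q' R' S') :
          Matrix.unitaryGroup (DPIdx P' Q' R' S') ℂ) : Matrix (DPIdx P' Q' R' S') (DPIdx P' Q' R' S') ℂ))
        (rename (matToDPIdx eA eR) F) = C (((a : Matrix P' P' ℂ).det) ^ e) * rename (matToDPIdx eA eR) F)
    (g : Matrix (Fin n) (Fin n) ℂ) (hg : g ∈ Matrix.unitaryGroup (Fin n) ℂ) : leftTranslate g F = C (g.det ^ e) * F := by
  have h1 := h ⟨ofVCMatrix eA g, ofVCMatrix_mem_unitaryGroup eA ⟨g, hg⟩⟩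
  rw [linSubst_star_dualPairι_kV_rename_matToDPIdx, Subtype.coe_mk, vcMatrix_ofVCMatrix, det_ofVCMatrix, ← rename_C,
    ← map_mul] at h1
  exact rename_injective _ (matToDPIdx_injective eA eR) h1

/-- the contravariant transfer. [folklore] -/
theorem det_pow_mul_leftTranslate_eq_of_kV {F : MvPolynomial (Fin n × Fin m) ℂ} {e : ℕ}
    (h : ∀ a : Matrix.unitaryGroup P' ℂ,
      C (((a : Matrix P' P' ℂ).det) ^ e) *
        linSubst (star ((dualPairι (((a, (1 : Matrix.unitaryGroup Q' ℂ)), (1, 1)) : DPK P' Q' R' S') :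
          Matrix.unitaryGroup (DPIdx P' Q' R' S') ℂ) : Matrix (DPIdx P' Q' R' S') (DPIdx P' Q' R' S') ℂ))
        (rename (matToDPIdx eA eR) F) = rename (matToDPIdx eA eR) F)
    (g : Matrix (Fin n) (Fin n) ℂ) (hg : g ∈ Matrix.unitaryGroup (Fin n) ℂ) : C (g.det ^ e) * leftTranslate g F = F := by
  have h1 := h ⟨ofVCMatrix eA g, ofVCMatrix_mem_unitaryGroup eA ⟨g, hg⟩⟩
  rw [linSubst_star_dualPairι_kV_rename_matToDPIdx, Subtype.coe_mk, vcMatrix_ofVCMatrix, det_ofVCMatrix, ← rename_C,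
    ← map_mul] at h1
  exact rename_injective _ (matToDPIdx_injective eA eR) h1

/-! ## §3 The isotypic Fock polynomials of a doubly definite slot -/

/-- **`K_V`-INVARIANT FOCK POLYNOMIALS OF A DOUBLY DEFINITE SLOT ARE CONSTANT** (`Q' = S' = ∅`, any ranks).
[GoodmanWallachGTM255, §5.2.1] -/
theorem eq_C_of_kV_invariant_delta [IsEmpty Q'] [IsEmpty S'] (G : MvPolynomial (DPIdx P' Q' R' S') ℂ)
    (h : ∀ a : Matrix.unitaryGroup P' ℂ,
      linSubst (star ((dualPairι (((a, (1 : Matrix.unitaryGroup Q' ℂ)), (1, 1)) : DPK P' Q' R' S') :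
          Matrix.unitaryGroup (DPIdx P' Q' R' S') ℂ) : Matrix (DPIdx P' Q' R' S') (DPIdx P' Q' R' S') ℂ)) G = G) :
    G = C (constantCoeff G) := by
  let eA := (Fintype.equivFin P').symm
  let eR := (Fintype.equivFin R').symm
  obtain ⟨F, rfl⟩ := exists_rename_eq_of_vars_subset_range G (matToDPIdx (Q' := Q') (S' := S') eA eR)
    (matToDPIdx_injective eA eR) fun v _ => matToDPIdx_surjective eA eR v
  have hF : F = C (constantCoeff F) :=
    eq_C_of_forall_unitary_leftTranslate_eq fun g hg => by
      have := leftTranslate_eq_of_kV eA eR (e := 0) (F := F) (fun a => by rw [pow_zero, C_1, one_mul]; exact h a) g hg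
      rwa [pow_zero, C_1, one_mul] at this
  rw [constantCoeff_rename]
  conv_lhs => rw [hF]
  rw [rename_C]

/-- **RELATIVE INVARIANTS OF POSITIVE DEGREE VANISH when `rank W_b < rank V_b`** (`Q' = S' = ∅`, `|R'| < |P'|`, exponent `e ≠ 0`):
`linSubst (dualPairι ((a,1),(1,1)))⋆ G = det(a)^e · G` for all `a ∈ U(P')` forces `G = 0`. [GoodmanWallachGTM255, §5.2.1; Sturmfels1993, §3.2] -/
theorem eq_zero_of_kV_relInvariant_delta [IsEmpty Q'] [IsEmpty S'] (hmn : Fintype.card R' < Fintype.card P') {e : ℕ} (he : e ≠ 0)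
    (G : MvPolynomial (DPIdx P' Q' R' S') ℂ)
    (h : ∀ a : Matrix.unitaryGroup P' ℂ,
      linSubst (star ((dualPairι (((a, (1 : Matrix.unitaryGroup Q' ℂ)), (1, 1)) : DPK P' Q' R' S') :
          Matrix.unitaryGroup (DPIdx P' Q' R' S') ℂ) : Matrix (DPIdx P' Q' R' S') (DPIdx P' Q' R' S') ℂ)) G =
        C (((a : Matrix P' P' ℂ).det) ^ e) * G) :
    G = 0 := by
  let eA := (Fintype.equivFin P').symm
  let eR := (Fintype.equivFin R').symm
  obtain ⟨F, rfl⟩ := exists_rename_eq_of_vars_subset_range G (matToDPIdx (Q' := Q') (S' := S') eA eR)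
    (matToDPIdx_injective eA eR) fun v _ => matToDPIdx_surjective eA eR v
  rw [eq_zero_of_forall_unitary_leftTranslate_eq_det_pow_mul hmn he (leftTranslate_eq_of_kV eA eR h), map_zero]

/-- **NEGATIVE RELATIVE DEGREE IS IMPOSSIBLE** (`Q' = S' = ∅`, `P'` nonempty, exponent `e ≠ 0`): `det(a)^e · linSubst (…) G = G` for all
`a ∈ U(P')` forces `G = 0`. [folklore] -/
theorem eq_zero_of_kV_relInvariant_delta_neg [IsEmpty Q'] [IsEmpty S'] [Nonempty P'] {e : ℕ} (he : e ≠ 0)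
    (G : MvPolynomial (DPIdx P' Q' R' S') ℂ)
    (h : ∀ a : Matrix.unitaryGroup P' ℂ,
      C (((a : Matrix P' P' ℂ).det) ^ e) *
        linSubst (star ((dualPairι (((a, (1 : Matrix.unitaryGroup Q' ℂ)), (1, 1)) : DPK P' Q' R' S') :
          Matrix.unitaryGroup (DPIdx P' Q' R' S') ℂ) : Matrix (DPIdx P' Q' R' S') (DPIdx P' Q' R' S') ℂ)) G = G) :
    G = 0 := by
  haveI : NeZero (Fintype.card P') := ⟨Fintype.card_ne_zero⟩
  let eA := (Fintype.equivFin P').symm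
  let eR := (Fintype.equivFin R').symm
  obtain ⟨F, rfl⟩ := exists_rename_eq_of_vars_subset_range G (matToDPIdx (Q' := Q') (S' := S') eA eR)
    (matToDPIdx_injective eA eR) fun v _ => matToDPIdx_surjective eA eR v
  rw [eq_zero_of_forall_unitary_det_pow_mul_leftTranslate_eq he (det_pow_mul_leftTranslate_eq_of_kV eA eR h), map_zero]

end Delta

end HodgeCM.Model.HypCensus

end
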